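import Summits.MatrixMultiplication.MatrixMultiplication.Theorems.AbelianSTPPCensusTECertDefs

/-!
# Certificate checker for `ShapeExclusionTE`: kernel evaluations, part A

Cell mm-stpp, route `AbelianSTPPCensus`, crux `ShapeExclusionTE` (stmt-MatrixMultiplication-19759); see the module docstring of
`AbelianSTPPCensusTECertDefs.lean` for the design of the certificate checker.  Support file (no new definitions).

Each theorem states that the reflective checker `teCheck M lo hi` (one order, maximal-member volume in `[lo, hi)`)
resp. `teBatch lo n` (orders `lo, …, lo+n-1`) returns `true`; proved by `decide` with kernel reduction (no
`native_decide`, axioms ⊆ {propext}).  The chunk sizes are dictated by the kernel's memory budget (measured in the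
seat folder: ≈ 12 000 filter evaluations + one order's tables per theorem).  Soundness is in the sibling files; the
chunks are assembled into `Covered M` for all `M ≤ 127` in `AbelianSTPPCensusShapeExclusionTE.lean`.
-/

-- single-conjunct summit: the mandated namespace repeats `MatrixMultiplication`.
set_option linter.dupNamespace false

namespace Summit.MatrixMultiplication.MatrixMultiplication.Theorems.TECert

-- Each evaluation is one kernel reduction of the checker (≈ 30 s, GMP arithmetic); heartbeats / recursion depth are
-- raised for these single computations only (tree precedent: `SoloInformedCwTwoCubeKoszulFourCert`).

set_option maxRecDepth 100000 in
set_option maxHeartbeats 0 in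
/-- The certificate checker accepts orders `0, …, 41` (whole search each, shared rows) (kernel evaluation, standard axioms). -/
theorem te_0_42 : teBatch 0 42 = true := by
  decide +kernel

set_option maxRecDepth 100000 in
set_option maxHeartbeats 0 in
/-- The certificate checker accepts orders `42, …, 61` (kernel evaluation, standard axioms). -/
theorem te_42_20 : teBatch 42 20 = true := by
  decide +kernel

set_option maxRecDepth 100000 in
set_option maxHeartbeats 0 in
/-- The certificate checker accepts orders `62, …, 75` (kernel evaluation, standard axioms). -/
theorem te_62_14 : teBatch 62 14 = true := by
  decide +kernel

set_option maxRecDepth 100000 in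
set_option maxHeartbeats 0 in
/-- The certificate checker accepts orders `76, …, 85` (kernel evaluation, standard axioms). -/
theorem te_76_10 : teBatch 76 10 = true := by
  decide +kernel

set_option maxRecDepth 100000 in
set_option maxHeartbeats 0 in
/-- The certificate checker accepts orders `86, …, 93` (kernel evaluation, standard axioms). -/
theorem te_86_8 : teBatch 86 8 = true := by
  decide +kernel

end Summit.MatrixMultiplication.MatrixMultiplication.Theorems.TECert
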